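import Literature.Geometry.Lorentzian.GaussEquationFrame
import Literature.Geometry.Lorentzian.CovariantDerivAlongLinear
import HarnessLib

/-!
# The Gauss formula, tangential part, for arbitrary tangent fields:
# `g(D_v(df Z), df w) = (f^*g)(∇_v Z, w)`

O'Neill 1983, Ch. 4, Lemma 3 (p. 98): for a semi-Riemannian submanifold with induced Levi-Civita
connection `∇` and ambient connection `D̄`, and `V, W` tangent, `∇_V W = tan D̄_V W`. The tree has
this identity for the coordinate frame fields `∂ₐ` of a chart along its coordinate lines
(`val_covariantDerivAlong_mfderiv_localFrame_chartLine`, `GaussFormulaTangential.lean`; second slot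
general in `val_covariantDerivAlong_mfderiv_localFrame_symm_comp₀`, `GaussEquationFrame.lean`).
This file proves it for an **arbitrary** tangent vector field `Z` of `N`, differentiable at the
point, and arbitrary directions: for a smooth spacelike immersion `f : (N, f^*g) → (M, g)`,

  `g(D_v (df ∘ Z), df w) = (f^*g)(∇_v Z, w)`  for all `v, w ∈ T_{y₀} N`

(`PseudoRiemannianMetric.val_normalDerivAlong_mfderiv_comp`), where `D_v` is the covariant
derivative along `f` of the field `y ↦ df_y (Z y)` (`normalDerivAlong`). Proof as printed: expand
`Z = ∑ Zᶜ ∂_c` in the coordinate frame at `y₀`; both sides are additive and Leibniz in `Z`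
(`covariantDerivAlong_add/smul` along the coordinate line, resp. the covariant-derivative axioms
of `∇`), agree on the frame fields by the frame version, and are linear in `v`.

Supporting lemmas of independent use: differentiability of lifts to `TM` of sums and scalar
multiples of fields along a curve (`mdifferentiableAt_lift_add`, `mdifferentiableAt_lift_smul`,
`mdifferentiableAt_lift_zero`) and along a map (`mdifferentiableAt_lift_add_map`,
`mdifferentiableAt_lift_smul_map`); the covariant derivative along a curve of a finite combination
`∑ aᵢ(t) Wᵢ(t)` (`covariantDerivAlong_zero`, `covariantDerivAlong_finset_sum_smul`; O'Neill 1983,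
Ch. 3, Prop. 3.18 (1)–(2)); and for the covariant derivative `D_v` along a map
(`normalDerivAlong`) additivity, the Leibniz rule and the restriction formula
(`PseudoRiemannianMetric.normalDerivAlong_add`, `….normalDerivAlong_smul`,
`….normalDerivAlong_comp`; O'Neill 1983, Ch. 4, Cor. 4.2).

As an application — the identity for which this file was written — the `3 + 1` split of the
Killing equation along a spacelike hypersurface, Chruściel–Costa 2008, §7.2, (7.1): for a vector
field `X` with `X ∘ f = Nf ν + df Z` (lapse `Nf`, shift `Z`),
`g(∇_{df u} X, df w) = Nf K_ν(u, w) + (f^*g)(∇_u Z, w)`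
(`PseudoRiemannianMetric.val_leviCivita_mfderiv_of_eq_lapse_shift`), hence for a **Killing** field
`D_i Z_j + D_j Z_i = -2 N K_{ij}`
(`PseudoRiemannianMetric.IsKillingField.inducedMetric_val_leviCivita_shift_symm_add`), the first
display of the Sudarsky–Wald staticity argument as printed there (companion of
`Literature.Geometry.Lorentzian.NonRotatingBlackHoleUniquenessProofs`).

Everything is proved; no definitions, no named facts.

## References

* B. O'Neill, *Semi-Riemannian geometry with applications to relativity*, Academic Press 1983,
  Ch. 3, Prop. 3.18 (induced covariant derivative on curves); Ch. 4, Lemma 1, Lemma 3, Prop. 8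
  (Gauss formula) (key `ONeill1983`).
* P. T. Chruściel, J. L. Costa, *On uniqueness of stationary vacuum black holes*, Astérisque 321
  (2008), arXiv:0806.0016, §7.2, (7.1) (key `ChruscielCosta2008`).
* R. M. Wald, *General Relativity*, Chicago 1984, §10.2, (10.2.11)–(10.2.13) (key `Wald1984`).
-/

noncomputable section

open Bundle Set Filter Function Manifold
open scoped Manifold ContDiff Topology

namespace Literature.Geometry.Lorentzian

variable {E : Type*} [NormedAddCommGroup E] [NormedSpace ℝ E] {H : Type*} [TopologicalSpace H]
  {I : ModelWithCorners ℝ E H} {M : Type*} [TopologicalSpace M] [ChartedSpace H M]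
  [IsManifold I ∞ M]

/-! ### Lifts to `TM` of sums and multiples of fields along a curve -/

section LiftAlgebra

/-- **The lift of the zero field along a differentiable curve is differentiable** (it is the
smooth zero section composed with the curve). [folklore] -/
theorem mdifferentiableAt_lift_zero {γ : ℝ → M} {t₀ : ℝ} (hγ : MDifferentiableAt 𝓘(ℝ, ℝ) I γ t₀) :
    MDifferentiableAt 𝓘(ℝ, ℝ) I.tangent
      (fun t ↦ (TotalSpace.mk' E (γ t) (0 : TangentSpace I (γ t)) : TangentBundle I M)) t₀ := by
  have h0 : ContMDiff I I.tangent ∞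
      (fun x : M ↦ (TotalSpace.mk' E x (0 : TangentSpace I x) : TangentBundle I M)) :=
    contMDiff_zeroSection ℝ (TangentSpace I : M → Type _)
  exact ((h0 _).mdifferentiableAt (by simp)).comp t₀ hγ

/-- **The lift of a sum of two fields along a curve is differentiable if both lifts are**: read in
the trivialisation of `TM` at `γ t₀`, whose fibre maps are linear, the fibre coordinate of
`W₁ + W₂` is the sum of the fibre coordinates near `t₀`. O'Neill 1983, Ch. 3, Prop. 3.18 (1)
(the component functions of `Z₁ + Z₂` are the sums of the component functions). [cite: ONeill1983, Ch. 3, Prop. 3.18 (1)] -/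
theorem mdifferentiableAt_lift_add {γ : ℝ → M} {W₁ W₂ : Π t : ℝ, TangentSpace I (γ t)} {t₀ : ℝ}
    (h₁ : MDifferentiableAt 𝓘(ℝ, ℝ) I.tangent
      (fun t ↦ (TotalSpace.mk' E (γ t) (W₁ t) : TangentBundle I M)) t₀)
    (h₂ : MDifferentiableAt 𝓘(ℝ, ℝ) I.tangent
      (fun t ↦ (TotalSpace.mk' E (γ t) (W₂ t) : TangentBundle I M)) t₀) :
    MDifferentiableAt 𝓘(ℝ, ℝ) I.tangent
      (fun t ↦ (TotalSpace.mk' E (γ t) (W₁ t + W₂ t) : TangentBundle I M)) t₀ := by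
  set e := trivializationAt E (TangentSpace I : M → Type _) (γ t₀) with he_def
  have he : γ t₀ ∈ e.baseSet := FiberBundle.mem_baseSet_trivializationAt' (γ t₀)
  have hγ : MDifferentiableAt 𝓘(ℝ, ℝ) I γ t₀ := mdifferentiableAt_of_mdifferentiableAt_lift h₁
  have c₁ := differentiableAt_trivialization_lift e h₁ he
  have c₂ := differentiableAt_trivialization_lift e h₂ he
  have hev : ∀ᶠ t in 𝓝 t₀, γ t ∈ e.baseSet :=
    hγ.continuousAt.preimage_mem_nhds (e.open_baseSet.mem_nhds he)
  refine (e.mdifferentiableAt_totalSpace_iff I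
    (fun t ↦ (TotalSpace.mk' E (γ t) (W₁ t + W₂ t) : TangentBundle I M)) (x₀ := t₀)
    ((e.mem_source).2 he)).2 ⟨hγ, ?_⟩
  have heq : (fun t ↦ (e (TotalSpace.mk' E (γ t) (W₁ t + W₂ t))).2) =ᶠ[𝓝 t₀]
      fun t ↦ (e (TotalSpace.mk' E (γ t) (W₁ t))).2 + (e (TotalSpace.mk' E (γ t) (W₂ t))).2 := by
    filter_upwards [hev] with t ht
    exact (e.linear ℝ ht).map_add (W₁ t) (W₂ t)
  exact (mdifferentiableAt_iff_differentiableAt.mpr (c₁.add c₂)).congr_of_eventuallyEq heq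

/-- **The lift of `a(t) • W(t)` is differentiable if `a` is and the lift of `W` is** (fibre
coordinates are linear). O'Neill 1983, Ch. 3, Prop. 3.18 (2). [cite: ONeill1983, Ch. 3, Prop. 3.18 (2)] -/
theorem mdifferentiableAt_lift_smul {γ : ℝ → M} {W : Π t : ℝ, TangentSpace I (γ t)} {a : ℝ → ℝ}
    {t₀ : ℝ} (ha : DifferentiableAt ℝ a t₀)
    (hW : MDifferentiableAt 𝓘(ℝ, ℝ) I.tangent
      (fun t ↦ (TotalSpace.mk' E (γ t) (W t) : TangentBundle I M)) t₀) :
    MDifferentiableAt 𝓘(ℝ, ℝ) I.tangent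
      (fun t ↦ (TotalSpace.mk' E (γ t) (a t • W t) : TangentBundle I M)) t₀ := by
  set e := trivializationAt E (TangentSpace I : M → Type _) (γ t₀) with he_def
  have he : γ t₀ ∈ e.baseSet := FiberBundle.mem_baseSet_trivializationAt' (γ t₀)
  have hγ : MDifferentiableAt 𝓘(ℝ, ℝ) I γ t₀ := mdifferentiableAt_of_mdifferentiableAt_lift hW
  have c := differentiableAt_trivialization_lift e hW he
  have hev : ∀ᶠ t in 𝓝 t₀, γ t ∈ e.baseSet :=
    hγ.continuousAt.preimage_mem_nhds (e.open_baseSet.mem_nhds he)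
  refine (e.mdifferentiableAt_totalSpace_iff I
    (fun t ↦ (TotalSpace.mk' E (γ t) (a t • W t) : TangentBundle I M)) (x₀ := t₀)
    ((e.mem_source).2 he)).2 ⟨hγ, ?_⟩
  have heq : (fun t ↦ (e (TotalSpace.mk' E (γ t) (a t • W t))).2) =ᶠ[𝓝 t₀]
      fun t ↦ a t • (e (TotalSpace.mk' E (γ t) (W t))).2 := by
    filter_upwards [hev] with t ht
    exact (e.linear ℝ ht).map_smul (a t) (W t)
  exact (mdifferentiableAt_iff_differentiableAt.mpr (ha.smul c)).congr_of_eventuallyEq heq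

variable [FiniteDimensional ℝ E] (cov : CovariantDerivative I E (TangentSpace I : M → Type _))

/-- **The covariant derivative along a curve of the zero field vanishes** (every coefficient
function in the defining frame formula is identically zero). [folklore] -/
theorem covariantDerivAlong_zero (γ : ℝ → M) (t₀ : ℝ) :
    covariantDerivAlong cov γ (fun t ↦ (0 : TangentSpace I (γ t))) t₀ = 0 := by
  rw [covariantDerivAlong_def, covariantDerivAlongFrame]
  simp

/-- **The covariant derivative along a curve of a finite combination `∑ᵢ aᵢ(t) Wᵢ(t)`**:
`D(∑ᵢ aᵢ Wᵢ)/dt = ∑ᵢ (aᵢ' Wᵢ + aᵢ DWᵢ/dt)` at `t₀`, for scalar functions `aᵢ` differentiable at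
`t₀` and fields `Wᵢ` along `γ` with differentiable lifts at `t₀` (`γ` differentiable at `t₀`);
and the lift of the combination is differentiable at `t₀`. Iteration of additivity and the Leibniz
rule (`covariantDerivAlong_add_holds`, `covariantDerivAlong_smul_holds`). O'Neill 1983, Ch. 3,
Prop. 3.18 (1)–(2). [cite: ONeill1983, Ch. 3, Prop. 3.18 (1)–(2)] -/
theorem covariantDerivAlong_finset_sum_smul {ι : Type*} (s : Finset ι) {γ : ℝ → M}
    {W : ι → Π t : ℝ, TangentSpace I (γ t)} {a : ι → ℝ → ℝ} {t₀ : ℝ}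
    (hγ : MDifferentiableAt 𝓘(ℝ, ℝ) I γ t₀)
    (hW : ∀ i ∈ s, MDifferentiableAt 𝓘(ℝ, ℝ) I.tangent
      (fun t ↦ (TotalSpace.mk' E (γ t) (W i t) : TangentBundle I M)) t₀)
    (ha : ∀ i ∈ s, DifferentiableAt ℝ (a i) t₀) :
    MDifferentiableAt 𝓘(ℝ, ℝ) I.tangent
        (fun t ↦ (TotalSpace.mk' E (γ t) (∑ i ∈ s, a i t • W i t) : TangentBundle I M)) t₀ ∧
      covariantDerivAlong cov γ (fun t ↦ ∑ i ∈ s, a i t • W i t) t₀ =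
        ∑ i ∈ s, (deriv (a i) t₀ • W i t₀ + a i t₀ • covariantDerivAlong cov γ (W i) t₀) := by
  classical
  induction s using Finset.induction_on with
  | empty =>
    simp only [Finset.sum_empty]
    exact ⟨mdifferentiableAt_lift_zero hγ, covariantDerivAlong_zero cov γ t₀⟩
  | @insert j s hj ih =>
    obtain ⟨ihd, ihe⟩ := ih (fun i hi ↦ hW i (Finset.mem_insert_of_mem hi))
      (fun i hi ↦ ha i (Finset.mem_insert_of_mem hi))
    have hWj := hW j (Finset.mem_insert_self j s)
    have haj := ha j (Finset.mem_insert_self j s)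
    have hjd := mdifferentiableAt_lift_smul haj hWj
    have hfun : (fun t ↦ ∑ i ∈ insert j s, a i t • W i t) =
        fun t ↦ a j t • W j t + ∑ i ∈ s, a i t • W i t := by
      funext t; rw [Finset.sum_insert hj]
    refine ⟨?_, ?_⟩
    · have := mdifferentiableAt_lift_add hjd ihd
      simpa only [Finset.sum_insert hj] using this
    · rw [hfun, covariantDerivAlong_add_holds cov hjd ihd, covariantDerivAlong_smul_holds cov haj hWj,
        ihe, Finset.sum_insert hj]

end LiftAlgebra

/-! ### The Gauss formula, tangential part, for a general tangent field -/

namespace PseudoRiemannianMetric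

variable [FiniteDimensional ℝ E] [CompleteSpace E]
  (g : PseudoRiemannianMetric I ∞ E (TangentSpace I : M → Type _)) [g.HasLeviCivita]
  {E' : Type*} [NormedAddCommGroup E'] [NormedSpace ℝ E'] {H' : Type*} [TopologicalSpace H']
  {I' : ModelWithCorners ℝ E' H'} {N : Type*} [TopologicalSpace N] [ChartedSpace H' N]
  [IsManifold I' ∞ N] [FiniteDimensional ℝ E'] [CompleteSpace E'] [I'.Boundaryless] {f : N → M}
  (hpb : contMDiff_pullbackBilin I M I' N ∞) (hfi : g.IsSpacelikeImmersion I' f)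

/-- **The Gauss formula, tangential part, for a general tangent field, in a coordinate direction.**
For a smooth spacelike immersion `f : (N, f^*g) → (M, g)`, a vector field `Z` of `N` differentiable
at `y₀`, the coordinate frame `∂_c` of the chart at `y₀` and `w ∈ T_{y₀} N`:
`g(D_{∂_d}(df ∘ Z), df w)(y₀) = (f^*g)(∇_{∂_d} Z, w)(y₀)`, `D` the covariant derivative along `f`
(`normalDerivAlong`, along the `d`-th coordinate line) and `∇` the Levi-Civita connection of
`f^*g`. Proof: `Z = ∑ Zᶜ ∂_c` near `y₀`, so along the coordinate line
`D(df Z) = ∑ ((Zᶜ)' df ∂_c + Zᶜ D(df ∂_c))` (`covariantDerivAlong_finset_sum_smul`), while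
`∇_{∂_d} Z = ∑ (dZᶜ(∂_d) ∂_c + Zᶜ ∇_{∂_d} ∂_c)` (`cov_apply_eq_sum_localFrame`); the frame
terms agree by the frame version `g(D_{∂_d}(df ∂_c), df w) = (f^*g)(∇_{∂_d} ∂_c, w)`
(`val_covariantDerivAlong_mfderiv_localFrame_symm_comp₀`) and the metric terms by
`(f^*g)(∂_c, w) = g(df ∂_c, df w)`. O'Neill 1983, Ch. 4, Lemma 1 and Lemma 3. [cite: ONeill1983, Ch. 4, Lemma 3] -/
theorem val_normalDerivAlong_mfderiv_comp_localFrame {ι : Type*} [Fintype ι] [DecidableEq ι]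
    (b' : Module.Basis ι ℝ E') {Z : Π y : N, TangentSpace I' y} {y₀ : N}
    (hZ : MDiffAt (T% Z) y₀) (d : ι) (w : TangentSpace I' y₀) :
    haveI := (g.inducedMetric f hpb hfi).hasLeviCivita
    g.val (f y₀) (g.normalDerivAlong f (fun y ↦ mfderiv I' I f y (Z y)) y₀
        ((trivializationAt E' (TangentSpace I') y₀).localFrame b' d y₀)) (mfderiv I' I f y₀ w) =
      (g.inducedMetric f hpb hfi).val y₀ ((g.inducedMetric f hpb hfi).leviCivita Z y₀
        ((trivializationAt E' (TangentSpace I') y₀).localFrame b' d y₀)) w := by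
  haveI := (g.inducedMetric f hpb hfi).hasLeviCivita
  set gN := g.inducedMetric f hpb hfi with hgN
  set e' := trivializationAt E' (TangentSpace I' : N → Type _) y₀ with he'
  -- regularity of `f`
  have hf : ContMDiff I' I ∞ f := IsSpacelikeImmersion.contMDiff_self hfi
  have hf2 : ContMDiff I' I 2 f := hf.of_le (by exact WithTop.coe_le_coe.2 le_top)
  have hfd : ∀ z, MDifferentiableAt I' I f z := hf2.mdifferentiable two_ne_zero
  have hy₀e : y₀ ∈ e'.baseSet := FiberBundle.mem_baseSet_trivializationAt' y₀
  have hz : extChartAt I' y₀ y₀ ∈ (extChartAt I' y₀).target := mem_extChartAt_target y₀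
  have hbd : e'.localFrame b' d y₀ = b' d := localFrame_trivializationAt_self b' y₀ d
  -- the `d`-th coordinate line `γN` through `y₀`
  set ℓ : ℝ → E' := fun t ↦ extChartAt I' y₀ y₀ + t • b' d with hℓdef
  have hℓ0 : ℓ 0 = extChartAt I' y₀ y₀ := by simp [hℓdef]
  have hℓ0t : ℓ 0 ∈ (extChartAt I' y₀).target := by rw [hℓ0]; exact hz
  have hℓaff : ∀ t, ℓ t = ℓ 0 + t • b' d := fun t ↦ by simp [hℓdef]
  have hℓ : HasDerivAt ℓ (b' d) 0 := by
    simpa [hℓdef] using ((hasDerivAt_id (0 : ℝ)).smul_const (b' d)).const_add (extChartAt I' y₀ y₀)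
  have hQ : (extChartAt I' y₀).symm (ℓ 0) = y₀ := by rw [hℓ0]; exact extChartAt_to_inv y₀
  set γN : ℝ → N := fun t ↦ (extChartAt I' y₀).symm (ℓ t) with hγN
  have hγN0 : γN 0 = y₀ := hQ
  have hγNs : ContMDiffAt 𝓘(ℝ, ℝ) I' ∞ γN 0 := by
    have := contMDiffAt_chartLine (I' := I') hz (b' d)
    simpa [hγN, hℓdef] using this
  have hγNd : MDifferentiableAt 𝓘(ℝ, ℝ) I' γN 0 := hγNs.mdifferentiableAt (by simp)
  have hQe : γN 0 ∈ e'.baseSet := by rw [hγN0]; exact hy₀e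
  have hZQ : MDiffAt (T% Z) (γN 0) := by rw [hγN0]; exact hZ
  -- `D_{∂_d}(df ∘ Z)(y₀)` is the covariant derivative along `f ∘ γN`
  have hLHS : g.normalDerivAlong f (fun y ↦ mfderiv I' I f y (Z y)) y₀ (e'.localFrame b' d y₀) =
      covariantDerivAlong g.leviCivita (fun t ↦ f (γN t))
        (fun t ↦ mfderiv I' I f (γN t) (Z (γN t))) 0 := by
    rw [hbd]
    rfl
  -- frame data
  set Zc : ι → N → ℝ := fun c y ↦ e'.localFrame_coeff I' b' c y (Z y) with hZc_def
  have hframe : ∀ c, MDiffAt (T% (e'.localFrame b' c)) (γN 0) := fun c ↦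
    (contMDiffAt_localFrame_of_mem 1 e' b' c hQe).mdifferentiableAt one_ne_zero
  have hZc : ∀ c, MDifferentiableAt I' 𝓘(ℝ, ℝ) (Zc c) (γN 0) := fun c ↦
    mdifferentiableAt_localFrame_coeff (I := I') (e := e') b' hQe hZQ c
  -- `df Z = ∑ Zᶜ df ∂_c` along the line, near `0`
  have hev : ∀ᶠ t in 𝓝 (0 : ℝ), γN t ∈ e'.baseSet :=
    hγNd.continuousAt.preimage_mem_nhds (e'.open_baseSet.mem_nhds hQe)
  have hexp : (fun t ↦ (TotalSpace.mk' E (f (γN t)) (mfderiv I' I f (γN t) (Z (γN t))) :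
      TangentBundle I M)) =ᶠ[𝓝 0]
      fun t ↦ (TotalSpace.mk' E (f (γN t))
        (∑ c, Zc c (γN t) • mfderiv I' I f (γN t) (e'.localFrame b' c (γN t))) :
          TangentBundle I M) := by
    filter_upwards [hev] with t ht
    have hZt : Z (γN t) = ∑ c, Zc c (γN t) • e'.localFrame b' c (γN t) := by
      have := e'.eq_sum_localFrame_coeff_smul (I := I') (b := b') (s := Z) ht
      simpa only using this
    rw [hZt, map_sum]
    simp only [map_smul]
  -- the combination rule along `f ∘ γN`
  have hWc : ∀ c ∈ (Finset.univ : Finset ι), MDifferentiableAt 𝓘(ℝ, ℝ) I.tangent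
      (fun t ↦ (TotalSpace.mk' E (f (γN t)) (mfderiv I' I f (γN t) (e'.localFrame b' c (γN t))) :
        TangentBundle I M)) 0 := fun c _ ↦
    (mdifferentiableAt_lift_mfderiv (I := I) (I' := I') hf2 (W := e'.localFrame b' c)
      (z₀ := γN 0) (hframe c)).comp 0 hγNd
  have hac : ∀ c ∈ (Finset.univ : Finset ι), DifferentiableAt ℝ (fun t ↦ Zc c (γN t)) 0 :=
    fun c _ ↦ (hasDerivAt_comp_curve (hZc c) hγNd).differentiableAt
  have hsum := (covariantDerivAlong_finset_sum_smul g.leviCivita (Finset.univ : Finset ι)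
    (γ := fun t ↦ f (γN t))
    (W := fun c t ↦ mfderiv I' I f (γN t) (e'.localFrame b' c (γN t)))
    (a := fun c t ↦ Zc c (γN t)) (t₀ := 0) ((hfd _).comp 0 hγNd) hWc hac).2
  -- the coefficient derivatives: `(Zᶜ ∘ γN)'(0) = dZᶜ(∂_d)`
  have hvelN : velocity I' γN 0 = e'.localFrame b' d (γN 0) := by
    have h1 := velocity_symm_comp₀ (I' := I') b' hℓ0t hℓ
    rw [sum_coord_basis_smul] at h1
    exact h1
  have hderiv : ∀ c, deriv (fun t ↦ Zc c (γN t)) 0 =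
      mfderiv I' 𝓘(ℝ, ℝ) (Zc c) (γN 0) (e'.localFrame b' d (γN 0)) := fun c ↦ by
    rw [(hasDerivAt_comp_curve (hZc c) hγNd).deriv, hvelN]
  -- the frame terms: Gauss formula on the frame, induced side on the frame
  have hGauss : ∀ c, g.val (f (γN 0))
      (covariantDerivAlong g.leviCivita (fun t ↦ f (γN t))
        (fun t ↦ mfderiv I' I f (γN t) (e'.localFrame b' c (γN t))) 0)
      (mfderiv I' I f (γN 0) w) =
      gN.val (γN 0) (gN.leviCivita (e'.localFrame b' c) (γN 0) (e'.localFrame b' d (γN 0))) w := by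
    intro c
    rw [val_covariantDerivAlong_mfderiv_localFrame_symm_comp₀ g hpb hfi b' hℓ0t hℓaff c w,
      covariantDerivAlong_localFrame_symm_comp₀ b' gN.leviCivita hℓ0t hℓ c, sum_coord_basis_smul]
  -- the induced side expanded in the frame
  have hRHS : gN.val (γN 0) (gN.leviCivita Z (γN 0) (e'.localFrame b' d (γN 0))) w =
      ∑ c, (Zc c (γN 0) *
          gN.val (γN 0) (gN.leviCivita (e'.localFrame b' c) (γN 0) (e'.localFrame b' d (γN 0))) w +
        (show ℝ from mfderiv I' 𝓘(ℝ, ℝ) (Zc c) (γN 0) (e'.localFrame b' d (γN 0))) *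
          gN.val (γN 0) (e'.localFrame b' c (γN 0)) w) := by
    rw [cov_apply_eq_sum_localFrame gN.leviCivita e' b' hQe hZQ, map_sum]
    simp only [map_add, map_smul, Finset.sum_apply, FunLike.coe_sum]
    rfl
  -- assemble at the base point `γN 0`
  have H : g.val (f (γN 0)) (covariantDerivAlong g.leviCivita (fun t ↦ f (γN t))
      (fun t ↦ mfderiv I' I f (γN t) (Z (γN t))) 0) (mfderiv I' I f (γN 0) w) =
      gN.val (γN 0) (gN.leviCivita Z (γN 0) (e'.localFrame b' d (γN 0))) w := by
    rw [covariantDerivAlong_congr_of_eventuallyEq g.leviCivita hexp, hsum, hRHS, map_sum]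
    simp only [map_add, map_smul, FunLike.coe_sum, Finset.sum_apply, FunLike.coe_add,
      FunLike.coe_smul, Pi.add_apply, Pi.smul_apply, smul_eq_mul]
    refine Finset.sum_congr rfl fun c _ ↦ ?_
    have hmet : g.val (f (γN 0)) (mfderiv I' I f (γN 0) (e'.localFrame b' c (γN 0)))
        (mfderiv I' I f (γN 0) w) = gN.val (γN 0) (e'.localFrame b' c (γN 0)) w := rfl
    linear_combination (Zc c (γN 0)) * hGauss c + deriv (fun t ↦ Zc c (γN t)) 0 * hmet +
      gN.val (γN 0) (e'.localFrame b' c (γN 0)) w * hderiv c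
  -- transfer to `y₀`
  have key : ∀ z, γN 0 = z →
      g.val (f z) (covariantDerivAlong g.leviCivita (fun t ↦ f (γN t))
        (fun t ↦ mfderiv I' I f (γN t) (Z (γN t))) 0) (mfderiv I' I f z w) =
      gN.val z (gN.leviCivita Z z (e'.localFrame b' d z)) w := by
    rintro z rfl
    exact H
  rw [hLHS]
  exact key y₀ hγN0

/-- **The Gauss formula, tangential part, for a general tangent field and a general direction**
(O'Neill 1983, Ch. 4, Lemma 3: `∇_V W = tan D̄_V W`): for a smooth spacelike immersion
`f : (N, f^*g) → (M, g)`, a vector field `Z` of `N` differentiable at `y₀` and `v, w ∈ T_{y₀} N`,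
`g(D_v (df ∘ Z), df w) = (f^*g)(∇_v Z, w)`. Both sides are linear in `v` (`normalDerivAlong_eq`
for the differentiable lift `y ↦ (f y, df_y(Z y))`, `mdifferentiableAt_lift_mfderiv`) and agree on
the coordinate frame at `y₀` (`val_normalDerivAlong_mfderiv_comp_localFrame`). [cite: ONeill1983, Ch. 4, Lemma 3] -/
theorem val_normalDerivAlong_mfderiv_comp {Z : Π y : N, TangentSpace I' y} {y₀ : N}
    (hZ : MDiffAt (T% Z) y₀) (v w : TangentSpace I' y₀) :
    haveI := (g.inducedMetric f hpb hfi).hasLeviCivita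
    g.val (f y₀) (g.normalDerivAlong f (fun y ↦ mfderiv I' I f y (Z y)) y₀ v)
        (mfderiv I' I f y₀ w) =
      (g.inducedMetric f hpb hfi).val y₀ ((g.inducedMetric f hpb hfi).leviCivita Z y₀ v) w := by
  haveI := (g.inducedMetric f hpb hfi).hasLeviCivita
  haveI : FiniteDimensional ℝ (TangentSpace I' y₀) := inferInstanceAs (FiniteDimensional ℝ E')
  set gN := g.inducedMetric f hpb hfi with hgN
  set bE := Module.finBasis ℝ E' with hbE
  have hf : ContMDiff I' I ∞ f := IsSpacelikeImmersion.contMDiff_self hfi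
  have hf2 : ContMDiff I' I 2 f := hf.of_le (by exact WithTop.coe_le_coe.2 le_top)
  -- the lift of `df ∘ Z` is differentiable at `y₀`, so `v ↦ D_v(df ∘ Z)` is a linear map `L`
  have hlift : MDifferentiableAt I' I.tangent
      (fun y ↦ (TotalSpace.mk' E (f y) (mfderiv I' I f y (Z y)) : TangentBundle I M)) y₀ :=
    mdifferentiableAt_lift_mfderiv (I := I) (I' := I') hf2 hZ
  let ψ : Fin (Module.finrank ℝ E) → (TangentSpace I' y₀ →L[ℝ] ℝ) := fun i ↦
    mfderiv I' 𝓘(ℝ, ℝ) (fun x ↦ (trivializationAt E (TangentSpace I : M → Type _)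
      (f y₀)).localFrame_coeff I (Module.finBasis ℝ E) i (f x) (mfderiv I' I f x (Z x))) y₀
  let L : TangentSpace I' y₀ →L[ℝ] TangentSpace I (f y₀) :=
    ∑ i, (ψ i).smulRight ((trivializationAt E (TangentSpace I : M → Type _) (f y₀)).localFrame
        (Module.finBasis ℝ E) i (f y₀)) +
      ∑ i, (trivializationAt E (TangentSpace I : M → Type _) (f y₀)).localFrame_coeff I
          (Module.finBasis ℝ E) i (f y₀) (mfderiv I' I f y₀ (Z y₀)) •
        (g.leviCivita ((trivializationAt E (TangentSpace I : M → Type _) (f y₀)).localFrame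
          (Module.finBasis ℝ E) i) (f y₀)).comp (mfderiv I' I f y₀)
  have hL : ∀ u, g.normalDerivAlong f (fun y ↦ mfderiv I' I f y (Z y)) y₀ u = L u := fun u ↦ by
    rw [g.normalDerivAlong_eq BoundarylessManifold.isInteriorPoint hlift u]
    simp only [L, ψ, add_apply, FunLike.coe_sum, Finset.sum_apply,
      ContinuousLinearMap.smulRight_apply, smul_apply, ContinuousLinearMap.comp_apply]
    rfl
  -- the two linear functionals of `v`
  let Φ₁ : TangentSpace I' y₀ →ₗ[ℝ] ℝ :=
    { toFun := fun u ↦ g.val (f y₀) (L u) (mfderiv I' I f y₀ w)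
      map_add' := fun u u' ↦ by simp
      map_smul' := fun r u ↦ by simp }
  let Φ₂ : TangentSpace I' y₀ →ₗ[ℝ] ℝ :=
    { toFun := fun u ↦ gN.val y₀ (gN.leviCivita Z y₀ u) w
      map_add' := fun u u' ↦ by simp
      map_smul' := fun r u ↦ by simp }
  suffices h : Φ₁ = Φ₂ by
    have h' : Φ₁ v = Φ₂ v := LinearMap.congr_fun h v
    change g.val (f y₀) (L v) (mfderiv I' I f y₀ w) = gN.val y₀ (gN.leviCivita Z y₀ v) w at h'
    rw [hL v]
    exact h'
  refine (bE : Module.Basis _ ℝ (TangentSpace I' y₀)).ext fun d ↦ ?_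
  have hb : (trivializationAt E' (TangentSpace I') y₀).localFrame bE d y₀ = bE d :=
    localFrame_trivializationAt_self bE y₀ d
  change g.val (f y₀) (L (bE d)) (mfderiv I' I f y₀ w) = gN.val y₀ (gN.leviCivita Z y₀ (bE d)) w
  rw [← hb, ← hL]
  exact g.val_normalDerivAlong_mfderiv_comp_localFrame hpb hfi bE hZ d w

end PseudoRiemannianMetric

/-! ### Lifts to `TM` of sums and multiples of fields along a map -/

section LiftAlgebraMap

variable {E' : Type*} [NormedAddCommGroup E'] [NormedSpace ℝ E'] {H' : Type*} [TopologicalSpace H']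
  {I' : ModelWithCorners ℝ E' H'} {N : Type*} [TopologicalSpace N] [ChartedSpace H' N]
  {f : N → M}

/-- **The lift of a sum of two fields along a map is differentiable if both lifts are** (fibre
coordinates in the trivialisation of `TM` at `f y` are linear). O'Neill 1983, Ch. 4, Lemma 1
(p. 98: component functions of fields along a submanifold). [cite: ONeill1983, Ch. 4, Lemma 1] -/
theorem mdifferentiableAt_lift_add_map {ν₁ ν₂ : Π x : N, TangentSpace I (f x)} {y : N}
    (h₁ : MDifferentiableAt I' I.tangent
      (fun x ↦ (TotalSpace.mk' E (f x) (ν₁ x) : TangentBundle I M)) y)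
    (h₂ : MDifferentiableAt I' I.tangent
      (fun x ↦ (TotalSpace.mk' E (f x) (ν₂ x) : TangentBundle I M)) y) :
    MDifferentiableAt I' I.tangent
      (fun x ↦ (TotalSpace.mk' E (f x) (ν₁ x + ν₂ x) : TangentBundle I M)) y := by
  set e := trivializationAt E (TangentSpace I : M → Type _) (f y) with he_def
  have he : f y ∈ e.baseSet := FiberBundle.mem_baseSet_trivializationAt' (f y)
  obtain ⟨hf, c₁⟩ := (e.mdifferentiableAt_totalSpace_iff I
    (fun x ↦ (TotalSpace.mk' E (f x) (ν₁ x) : TangentBundle I M)) (x₀ := y)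
    ((e.mem_source).2 he)).1 h₁
  obtain ⟨-, c₂⟩ := (e.mdifferentiableAt_totalSpace_iff I
    (fun x ↦ (TotalSpace.mk' E (f x) (ν₂ x) : TangentBundle I M)) (x₀ := y)
    ((e.mem_source).2 he)).1 h₂
  have hev : ∀ᶠ x in 𝓝 y, f x ∈ e.baseSet :=
    hf.continuousAt.preimage_mem_nhds (e.open_baseSet.mem_nhds he)
  refine (e.mdifferentiableAt_totalSpace_iff I
    (fun x ↦ (TotalSpace.mk' E (f x) (ν₁ x + ν₂ x) : TangentBundle I M)) (x₀ := y)
    ((e.mem_source).2 he)).2 ⟨hf, ?_⟩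
  have heq : (fun x ↦ (e (TotalSpace.mk' E (f x) (ν₁ x + ν₂ x))).2) =ᶠ[𝓝 y]
      fun x ↦ (e (TotalSpace.mk' E (f x) (ν₁ x))).2 + (e (TotalSpace.mk' E (f x) (ν₂ x))).2 := by
    filter_upwards [hev] with x hx
    exact (e.linear ℝ hx).map_add (ν₁ x) (ν₂ x)
  exact (c₁.add c₂).congr_of_eventuallyEq heq

/-- **The lift of `a • ν` along a map is differentiable if `a` and the lift of `ν` are.**
O'Neill 1983, Ch. 4, Lemma 1. [cite: ONeill1983, Ch. 4, Lemma 1] -/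
theorem mdifferentiableAt_lift_smul_map {ν : Π x : N, TangentSpace I (f x)} {a : N → ℝ} {y : N}
    (ha : MDifferentiableAt I' 𝓘(ℝ, ℝ) a y)
    (hν : MDifferentiableAt I' I.tangent
      (fun x ↦ (TotalSpace.mk' E (f x) (ν x) : TangentBundle I M)) y) :
    MDifferentiableAt I' I.tangent
      (fun x ↦ (TotalSpace.mk' E (f x) (a x • ν x) : TangentBundle I M)) y := by
  set e := trivializationAt E (TangentSpace I : M → Type _) (f y) with he_def
  have he : f y ∈ e.baseSet := FiberBundle.mem_baseSet_trivializationAt' (f y)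
  obtain ⟨hf, c⟩ := (e.mdifferentiableAt_totalSpace_iff I
    (fun x ↦ (TotalSpace.mk' E (f x) (ν x) : TangentBundle I M)) (x₀ := y)
    ((e.mem_source).2 he)).1 hν
  have hev : ∀ᶠ x in 𝓝 y, f x ∈ e.baseSet :=
    hf.continuousAt.preimage_mem_nhds (e.open_baseSet.mem_nhds he)
  refine (e.mdifferentiableAt_totalSpace_iff I
    (fun x ↦ (TotalSpace.mk' E (f x) (a x • ν x) : TangentBundle I M)) (x₀ := y)
    ((e.mem_source).2 he)).2 ⟨hf, ?_⟩
  have heq : (fun x ↦ (e (TotalSpace.mk' E (f x) (a x • ν x))).2) =ᶠ[𝓝 y]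
      fun x ↦ a x • (e (TotalSpace.mk' E (f x) (ν x))).2 := by
    filter_upwards [hev] with x hx
    exact (e.linear ℝ hx).map_smul (a x) (ν x)
  exact (ha.smul c).congr_of_eventuallyEq heq

end LiftAlgebraMap

/-! ### Additivity, Leibniz rule and restriction for `D_v` along a map -/

namespace PseudoRiemannianMetric

variable [FiniteDimensional ℝ E]
  (g : PseudoRiemannianMetric I ∞ E (TangentSpace I : M → Type _)) [g.HasLeviCivita]
  {E' : Type*} [NormedAddCommGroup E'] [NormedSpace ℝ E'] {H' : Type*} [TopologicalSpace H']
  {I' : ModelWithCorners ℝ E' H'} {N : Type*} [TopologicalSpace N] [ChartedSpace H' N]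
  [IsManifold I' ∞ N] [I'.Boundaryless] {f : N → M}

/-- **`D_v(ν₁ + ν₂) = D_v ν₁ + D_v ν₂`** for fields along `f` with differentiable lifts at `y`
(`covariantDerivAlong_add_holds` along the chart-straight curve of velocity `v`). O'Neill 1983,
Ch. 4, Cor. 4.2 (1) (the induced connection is linear). [cite: ONeill1983, Ch. 4, Cor. 4.2 (1)] -/
theorem normalDerivAlong_add {ν₁ ν₂ : NormalField I f} {y : N}
    (h₁ : MDifferentiableAt I' I.tangent
      (fun x ↦ (TotalSpace.mk' E (f x) (ν₁ x) : TangentBundle I M)) y)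
    (h₂ : MDifferentiableAt I' I.tangent
      (fun x ↦ (TotalSpace.mk' E (f x) (ν₂ x) : TangentBundle I M)) y)
    (v : TangentSpace I' y) :
    g.normalDerivAlong f (fun x ↦ ν₁ x + ν₂ x) y v =
      g.normalDerivAlong f ν₁ y v + g.normalDerivAlong f ν₂ y v := by
  have hc := mdifferentiableAt_curveThrough_zero
    (BoundarylessManifold.isInteriorPoint (I := I') (x := y)) v
  have lift : ∀ {ν : NormalField I f}, MDifferentiableAt I' I.tangent
      (fun x ↦ (TotalSpace.mk' E (f x) (ν x) : TangentBundle I M)) y →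
      MDifferentiableAt 𝓘(ℝ, ℝ) I.tangent (fun t ↦ (TotalSpace.mk' E (f (curveThrough I' y v t))
        (ν (curveThrough I' y v t)) : TangentBundle I M)) 0 := by
    intro ν hν
    have hν' : MDifferentiableAt I' I.tangent
        (fun x ↦ (TotalSpace.mk' E (f x) (ν x) : TangentBundle I M)) (curveThrough I' y v 0) := by
      rw [curveThrough_zero]; exact hν
    exact hν'.comp 0 hc
  exact covariantDerivAlong_add_holds g.leviCivita (lift h₁) (lift h₂)

/-- **`D_v(a ν) = da(v) ν + a D_v ν`** for a scalar `a` differentiable at `y` and a field `ν`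
along `f` with differentiable lift at `y` (`covariantDerivAlong_smul_holds` along the
chart-straight curve, and the chain rule for `a`). O'Neill 1983, Ch. 4, Cor. 4.2 (2); Ch. 3,
Prop. 3.18 (2). [cite: ONeill1983, Ch. 3, Prop. 3.18 (2)] -/
theorem normalDerivAlong_smul {ν : NormalField I f} {a : N → ℝ} {y : N}
    (ha : MDifferentiableAt I' 𝓘(ℝ, ℝ) a y)
    (hν : MDifferentiableAt I' I.tangent
      (fun x ↦ (TotalSpace.mk' E (f x) (ν x) : TangentBundle I M)) y)
    (v : TangentSpace I' y) :
    g.normalDerivAlong f (fun x ↦ a x • ν x) y v =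
      mvfderiv I' a y v • ν y + a y • g.normalDerivAlong f ν y v := by
  set c : ℝ → N := curveThrough I' y v with hc_def
  have hc0 : c 0 = y := curveThrough_zero I' y v
  have hcs : MDifferentiableAt 𝓘(ℝ, ℝ) I' c 0 :=
    mdifferentiableAt_curveThrough_zero BoundarylessManifold.isInteriorPoint v
  have hν' : MDifferentiableAt I' I.tangent
      (fun x ↦ (TotalSpace.mk' E (f x) (ν x) : TangentBundle I M)) (c 0) := by
    rw [hc0]; exact hν
  have hνlift : MDifferentiableAt 𝓘(ℝ, ℝ) I.tangent
      (fun s ↦ (TotalSpace.mk' E (f (c s)) (ν (c s)) : TangentBundle I M)) 0 := hν'.comp 0 hcs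
  have ha' : MDifferentiableAt I' 𝓘(ℝ, ℝ) a (c 0) := by rw [hc0]; exact ha
  have hac : HasDerivAt (fun s ↦ a (c s)) (mfderiv I' 𝓘(ℝ, ℝ) a (c 0) (velocity I' c 0)) 0 :=
    hasDerivAt_comp_curve ha' hcs
  have hvc : velocity I' c 0 = v :=
    velocity_curveThrough_zero_holds BoundarylessManifold.isInteriorPoint v
  have hderiv : deriv (fun s ↦ a (c s)) 0 = mvfderiv I' a y v := by
    rw [hac.deriv]
    have key : ∀ z : N, z = y → ∀ u' : TangentSpace I' z, (show E' from u') = (show E' from v) →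
        (mfderiv I' 𝓘(ℝ, ℝ) a z u' : ℝ) = mvfderiv I' a y v := by
      rintro z rfl u' rfl; rfl
    exact key _ hc0 _ hvc
  have hL := covariantDerivAlong_smul_holds g.leviCivita (γ := fun s ↦ f (c s))
    (W := fun t ↦ ν (c t)) (f := fun t ↦ a (c t)) (t₀ := 0) hac.differentiableAt hνlift
  change (covariantDerivAlong g.leviCivita (fun s ↦ f (c s)) (fun t ↦ a (c t) • ν (c t)) 0 : E) = _
  rw [hL, hderiv]
  have key : ∀ z : N, y = z →
      (show E from mvfderiv I' a y v • ν z) + (show E from a z •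
        covariantDerivAlong g.leviCivita (fun s ↦ f (c s)) (fun s ↦ ν (c s)) 0) =
      (show E from mvfderiv I' a y v • ν y) + (show E from a y • g.normalDerivAlong f ν y v) := by
    rintro z rfl; rfl
  exact key _ hc0.symm

omit [I'.Boundaryless] in
/-- **`D_v (X ∘ f) = ∇_{df v} X`** for a vector field `X` of `M` differentiable at `f y` (at an
interior point `y`, `f` differentiable at `y`): restriction of vector fields along a map
(`covariantDerivAlong_comp_holds` along the chart-straight curve and the chain rule for its
velocity). O'Neill 1983, Ch. 3, Prop. 3.18 (3) and Ch. 4, Lemma 4.1. (Restated from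
`Literature.Geometry.Riemannian.normalDerivAlong_comp_eq_leviCivita`, whose file carries the
round-sphere material and is not imported here.) [cite: ONeill1983, Ch. 3, Prop. 3.18 (3)] -/
theorem normalDerivAlong_comp {X : Π x : M, TangentSpace I x} {y : N}
    (hy : I'.IsInteriorPoint y) (hf : MDifferentiableAt I' I f y)
    (hX : MDiffAt (T% X) (f y)) (w : TangentSpace I' y) :
    g.normalDerivAlong f (fun x ↦ X (f x)) y w = g.leviCivita X (f y) (mfderiv I' I f y w) := by
  have hc := mdifferentiableAt_curveThrough_zero hy w
  have hf' : MDifferentiableAt I' I f (curveThrough I' y w 0) := by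
    rw [curveThrough_zero]; exact hf
  have hX' : MDiffAt (T% X) ((f ∘ curveThrough I' y w) 0) := by
    rw [Function.comp_apply, curveThrough_zero]; exact hX
  have h := covariantDerivAlong_comp_holds g.leviCivita (γ := f ∘ curveThrough I' y w) (Y := X)
    (t₀ := 0) (hf'.comp 0 hc) hX'
  have hv : velocity I (f ∘ curveThrough I' y w) 0 =
      mfderiv I' I f (curveThrough I' y w 0) (velocity I' (curveThrough I' y w) 0) := by
    simp only [velocity]
    rw [mfderiv_comp 0 hf' hc]
    rfl
  rw [hv] at h
  simp only [Function.comp_apply] at h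
  rw [curveThrough_zero, velocity_curveThrough_zero_holds hy w] at h
  exact h

end PseudoRiemannianMetric

/-! ### Application: the `3 + 1` split of the Killing equation along a spacelike hypersurface
(Chruściel–Costa 2008, §7.2, (7.1)) -/

namespace PseudoRiemannianMetric

variable [FiniteDimensional ℝ E] [CompleteSpace E]
  (g : PseudoRiemannianMetric I ∞ E (TangentSpace I : M → Type _)) [g.HasLeviCivita]
  {E' : Type*} [NormedAddCommGroup E'] [NormedSpace ℝ E'] {H' : Type*} [TopologicalSpace H']
  {I' : ModelWithCorners ℝ E' H'} {N : Type*} [TopologicalSpace N] [ChartedSpace H' N]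
  [IsManifold I' ∞ N] [FiniteDimensional ℝ E'] [CompleteSpace E'] [I'.Boundaryless] {f : N → M}
  (hpb : contMDiff_pullbackBilin I M I' N ∞) (hfi : g.IsSpacelikeImmersion I' f)

/-- **Tangential derivatives of a field split into lapse and shift along a slice.** Let
`f : (N, f^*g) → (M, g)` be a smooth spacelike immersion with a normal field `ν` (smooth lift),
and `X` a vector field of `M`, differentiable along `f`, which along the slice splits as
`X ∘ f = Nf ν + df Z` with a differentiable *lapse* `Nf : N → ℝ` and a differentiable *shift*
`Z` (a vector field of `N`). Then for `u, w ∈ T_y N`: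
`g(∇_{df u} X, df w) = Nf(y) K_ν(u, w) + (f^*g)(∇_u Z, w)` — restriction
(`normalDerivAlong_comp`), `D_u(Nf ν + df Z) = dNf(u) ν + Nf D_u ν + D_u(df Z)`
(`normalDerivAlong_add/smul`), `g(ν, df w) = 0`, `g(D_u ν, df w) = K_ν(u, w)`
(`secondFundamentalForm_apply_holds`) and the Gauss formula `g(D_u(df Z), df w) = (f^*g)(∇_u Z, w)`
(`val_normalDerivAlong_mfderiv_comp`). Wald 1984, §10.2 ((10.2.11)–(10.2.13): `t^a = N n^a + N^a`,
`K_{ab} = h_a{}^c ∇_c n_b`); Chruściel–Costa 2008, §7.2 (the decomposition `X = N n + Z` along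
`Σ''`). [cite: ChruscielCosta2008, §7.2 (decomposition X = Nn + Z along the slice)] -/
theorem val_leviCivita_mfderiv_of_eq_lapse_shift
    {ν : NormalField I f}
    (hν : ContMDiff I' I.tangent ∞ (fun x ↦ (TotalSpace.mk' E (f x) (ν x) : TangentBundle I M)))
    (hn : g.IsNormalTo I' f ν)
    {X : Π x : M, TangentSpace I x} (hXd : ∀ x, MDiffAt (T% X) x)
    {Nf : N → ℝ} (hNd : ∀ y, MDifferentiableAt I' 𝓘(ℝ, ℝ) Nf y)
    {Z : Π y : N, TangentSpace I' y} (hZ : ∀ y, MDiffAt (T% Z) y)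
    (hsplit : ∀ y, X (f y) = Nf y • ν y + mfderiv I' I f y (Z y)) (y : N)
    (u w : TangentSpace I' y) :
    haveI := (g.inducedMetric f hpb hfi).hasLeviCivita
    g.val (f y) (g.leviCivita X (f y) (mfderiv I' I f y u)) (mfderiv I' I f y w) =
      Nf y * g.secondFundamentalForm I' f ν y u w +
        (g.inducedMetric f hpb hfi).val y ((g.inducedMetric f hpb hfi).leviCivita Z y u) w := by
  haveI := (g.inducedMetric f hpb hfi).hasLeviCivita
  have hf : ContMDiff I' I ∞ f := IsSpacelikeImmersion.contMDiff_self hfi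
  have hf2 : ContMDiff I' I 2 f := hf.of_le (by exact WithTop.coe_le_coe.2 le_top)
  have hfd : MDifferentiableAt I' I f y := hf2.mdifferentiableAt two_ne_zero
  have hνd : MDifferentiableAt I' I.tangent
      (fun x ↦ (TotalSpace.mk' E (f x) (ν x) : TangentBundle I M)) y :=
    (hν y).mdifferentiableAt (by simp)
  have hZl : MDifferentiableAt I' I.tangent
      (fun x ↦ (TotalSpace.mk' E (f x) (mfderiv I' I f x (Z x)) : TangentBundle I M)) y :=
    mdifferentiableAt_lift_mfderiv (I := I) (I' := I') hf2 (hZ y)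
  have hNν : MDifferentiableAt I' I.tangent
      (fun x ↦ (TotalSpace.mk' E (f x) (Nf x • ν x) : TangentBundle I M)) y :=
    mdifferentiableAt_lift_smul_map (hNd y) hνd
  have hXf : (fun x ↦ X (f x)) = fun x ↦ Nf x • ν x + mfderiv I' I f x (Z x) := funext hsplit
  rw [← g.normalDerivAlong_comp BoundarylessManifold.isInteriorPoint hfd (hXd (f y)) u, hXf,
    g.normalDerivAlong_add hNν hZl, g.normalDerivAlong_smul (hNd y) hνd, map_add, map_add,
    map_smul, map_smul]
  simp only [FunLike.coe_add, FunLike.coe_smul, Pi.add_apply, Pi.smul_apply, smul_eq_mul]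
  rw [hn y w, mul_zero, zero_add,
    ← secondFundamentalForm_apply_holds (g := g) (I' := I') BoundarylessManifold.isInteriorPoint
      hνd u w,
    g.val_normalDerivAlong_mfderiv_comp hpb hfi (hZ y) u w]

/-- **The `3 + 1` split of the Killing equation along a spacelike hypersurface
(Chruściel–Costa 2008, (7.1)).** Let `f : (N, f^*g) → (M, g)` be a smooth spacelike immersion
with normal field `ν` (smooth lift), and `X` a **Killing** field of `g` splitting along the slice
as `X ∘ f = Nf ν + df Z` (lapse `Nf`, shift `Z`, both differentiable). Then for all
`u, w ∈ T_y N`: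
`(f^*g)(∇_u Z, w) + (f^*g)(∇_w Z, u) = -2 Nf(y) K_ν(u, w)`, i.e. `D_i Z_j + D_j Z_i = -2N K_{ij}`
with `K = g(Dν, df ·)` (Wald's `K_{ab} = ∇_a n_b`): the Killing equation
`g(∇_{df u} X, df w) + g(df u, ∇_{df w} X) = 0`, the previous lemma for both terms, and the
symmetry of `K_ν` (`secondFundamentalForm_symm_holds`). Printed: "The space-time Killing equations
imply `D_i Z_j + D_j Z_i = -2N K_{ij}` (7.1), where `g_{ij}` is the metric induced on `Σ''`,
`K_{ij}` is its extrinsic curvature tensor, and `D` is the covariant derivative operator of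
`g_{ij}`" (Chruściel–Costa 2008, §7.2; on the maximal slice this feeds `D_i(K^{ij}Z_j) =
-N K^{ij}K_{ij}` and Sudarsky–Wald's integral identity). [cite: ChruscielCosta2008, §7.2 (7.1)] -/
theorem IsKillingField.inducedMetric_val_leviCivita_shift_symm_add
    {ν : NormalField I f}
    (hν : ContMDiff I' I.tangent ∞ (fun x ↦ (TotalSpace.mk' E (f x) (ν x) : TangentBundle I M)))
    (hn : g.IsNormalTo I' f ν)
    {X : Π x : M, TangentSpace I x} (hX : g.IsKillingField X)
    {Nf : N → ℝ} (hNd : ∀ y, MDifferentiableAt I' 𝓘(ℝ, ℝ) Nf y)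
    {Z : Π y : N, TangentSpace I' y} (hZ : ∀ y, MDiffAt (T% Z) y)
    (hsplit : ∀ y, X (f y) = Nf y • ν y + mfderiv I' I f y (Z y)) (y : N)
    (u w : TangentSpace I' y) :
    haveI := (g.inducedMetric f hpb hfi).hasLeviCivita
    (g.inducedMetric f hpb hfi).val y ((g.inducedMetric f hpb hfi).leviCivita Z y u) w +
        (g.inducedMetric f hpb hfi).val y ((g.inducedMetric f hpb hfi).leviCivita Z y w) u =
      -2 * Nf y * g.secondFundamentalForm I' f ν y u w := by
  haveI := (g.inducedMetric f hpb hfi).hasLeviCivita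
  have hf : ContMDiff I' I ∞ f := IsSpacelikeImmersion.contMDiff_self hfi
  have hf2 : ContMDiff I' I 2 f := hf.of_le (by exact WithTop.coe_le_coe.2 le_top)
  have hν1 : ContMDiff I' I.tangent 1
      (fun x ↦ (TotalSpace.mk' E (f x) (ν x) : TangentBundle I M)) :=
    hν.of_le (by exact WithTop.coe_le_coe.2 le_top)
  have hXd : ∀ x, MDiffAt (T% X) x := fun x ↦ (hX.contMDiff x).mdifferentiableAt (by simp)
  -- the Killing equation on `df u`, `df w`
  have hk := hX.2 (f y) (mfderiv I' I f y u) (mfderiv I' I f y w)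
  rw [g.symm (f y) (mfderiv I' I f y u) (g.leviCivita X (f y) (mfderiv I' I f y w)),
    g.val_leviCivita_mfderiv_of_eq_lapse_shift hpb hfi hν hn hXd hNd hZ hsplit y u w,
    g.val_leviCivita_mfderiv_of_eq_lapse_shift hpb hfi hν hn hXd hNd hZ hsplit y w u] at hk
  -- symmetry of the second fundamental form
  have hsymm := (secondFundamentalForm_symm_holds (g := g) (I' := I') hf2 hn hν1
    (y := y) BoundarylessManifold.isInteriorPoint).eq w u
  rw [hsymm] at hk
  linarith

end PseudoRiemannianMetric

end Literature.Geometry.Lorentzian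

end
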